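import Summits.Ventures.LatticeQCDFlow.Scaling.SimulatedTemperingFiniteGap
import Literature.Probability.MarkovChains.SpectralGapTestFunction

/-!
HONEST FRAMING: exact (Metropolis-corrected) sampling algorithms for lattice gauge theory; figures
of merit are autocorrelation/cost numbers at stated couplings and volumes; no continuum-physics
claim.

# SimulatedTemperingCommonMode — A TEMPERING SAMPLER INHERITS EVERY SLOW MODE COMMON TO ALL ITS LEVELS: FOR EVERY
# OBSERVABLE `h` OF THE CONFIGURATION, `Gap ≤ (1−t)·Σ_k 𝓔_{μ_k}(M_k; h)/Σ_k Var_{μ_k}(h)`; IF `h` IS `ε`-SLOW AT EVERY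
# LEVEL THEN `Gap ≤ (1−t)ε` AND `τ_int(h) ≥ 1/((1−t)ε) − ½`, WHATEVER THE LADDER (lean-2 GEN-17, ours)

Venture-side (OURS).  Cell `lqcd-flow` (pub-lqcd), unit `pub-lqcd-lean-2-g17`, 2026-08-25.  Setting of chapter X
(`Scaling/SimulatedTemperingFiniteSampler`): finite configuration space `S`, levels `μ_k` (positive probability
vectors, exact weights), within-level updates `M_k` (row-stochastic, `μ_k`-reversible), the random-scan sampler
`P = stFinSampler t μ M` on `Fin (K+1) × S`, target `π = stFinLaw μ`.  `Scaling/SimulatedTemperingModeTorpid` bounded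
the gap by the ladder-averaged exit flow of a SET of configurations; this file is the same principle for an arbitrary
OBSERVABLE `h : S → ℝ` of the configuration, read at whatever level the sampler is (`g(k,x) = h(x)`).

## What is proved (finite-chain vocabulary of `Literature.Probability.MarkovChains`)

* §1 `stFin_flow_mul_sq_comp_snd` — termwise, the level move contributes nothing to the Dirichlet form of `g = h∘snd`
  (it keeps the configuration); **`stFin_dirichletForm_comp_snd`** —
  `𝓔_π(P; h∘snd) = ((1−t)/(K+1))·Σ_k 𝓔_{μ_k}(M_k; h)` EXACTLY; **`stFin_lawVariance_comp_snd_ge`** —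
  `Var_π(h∘snd) ≥ (1/(K+1))·Σ_k Var_{μ_k}(h)` (the within-level part of the variance decomposition along the levels).
* §2 **`stFin_spectralGap_le_commonMode`** — `Gap(P) ≤ (1−t)·Σ_k 𝓔_{μ_k}(M_k; h)/Σ_k Var_{μ_k}(h)` for every `h` with
  `Σ_k Var_{μ_k}(h) > 0` (`0 ≤ t ≤ 1`, `K ≥ 1`; Levin–Peres–Wilmer Remark 13.8 + Lemma 13.7, PROVED in the tree);
  **`stFin_spectralGap_le_of_slow`** — if `𝓔_{μ_k}(M_k; h) ≤ ε·Var_{μ_k}(h)` at EVERY level then `Gap(P) ≤ (1−t)ε`.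
* §3 **`stFin_tauInt_comp_snd_ge`** — `0 < t < 1`, irreducible `M_k`:
  `τ_int(h∘snd) = asympVar/(2Var) ≥ Σ_k Var_{μ_k}(h)/((1−t)·Σ_k 𝓔_{μ_k}(M_k; h)) − ½`;
  **`stFin_tauInt_ge_of_slow`** — `ε`-slow at every level ⇒ `τ_int(h∘snd) ≥ 1/((1−t)ε) − ½`.

Reading (no numerics implied): tempering in the coupling helps only with bottlenecks that SOME level does not have —
an observable that is slow under every within-level update (a topological charge frozen at every coupling of the
window, a Polyakov-loop sector, …) is exactly as slow under the tempering sampler, up to the factor `1/(1−t)` paid for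
the level moves; by the mediant inequality the bound is at most `(1−t)·max_k 𝓔_k(h)/Var_k(h)`.  NOT CLAIMED: the
positive counterpart (it is `Scaling/SimulatedTemperingModeGap`, which needs a level where `h` is FAST); replica
exchange (the additive observable `Σ_k h(x_k)` — not typed here); general configuration spaces; anything measured.
Literature grade (cell rule): KNOWN MECHANISM (test-function ceilings on spectral gaps; "tempering cannot fix a
bottleneck present at all temperatures" — Woodard–Schmidler–Huber 2009, Bhatnagar–Randall 2004), NEW TYPING (the exact
Dirichlet-form identity for configuration observables of the exact-weight finite sampler); nothing cited as a fact;
no new bib keys.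
-/

noncomputable section

open Finset
open Literature.Probability.MarkovChains
open Literature.Probability.MarkovChains.Decomposition

namespace Summit.Ventures.LatticeQCDFlow.Scaling

variable {S : Type*} [Fintype S] [DecidableEq S] {K : ℕ} {μ : Fin (K + 1) → S → ℝ}
  {M : Fin (K + 1) → Matrix S S ℝ} {t : ℝ}

/-! ## §1 The Dirichlet form and the variance of a configuration observable -/

/-- Termwise: `π(k,x)P((k,x),(l,y))(h x − h y)² = [l = k]·π(k,x)(1−t)M_k(x,y)(h x − h y)²` — the level move keeps the
configuration, so it never contributes. [ours] -/
theorem stFin_flow_mul_sq_comp_snd (h : S → ℝ) (k l : Fin (K + 1)) (x y : S) :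
    stFinLaw μ (k, x) * stFinSampler t μ M (k, x) (l, y) * (h x - h y) ^ 2
      = if l = k then stFinLaw μ (k, x) * ((1 - t) * M k x y) * (h x - h y) ^ 2 else 0 := by
  by_cases hyx : y = x
  · subst hyx
    simp
  · have hne : ((l, y) : Fin (K + 1) × S).2 ≠ ((k, x) : Fin (K + 1) × S).2 := hyx
    rw [stFinSampler_apply, stFinLevel_eq_zero_of_ne hne, mul_zero, zero_add, stFinWithin_apply]
    by_cases hlk : l = k
    · subst hlk
      rw [if_pos rfl, if_pos rfl]
    · have hlk' : ¬ ((l, y) : Fin (K + 1) × S).1 = ((k, x) : Fin (K + 1) × S).1 := hlk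
      rw [if_neg hlk', if_neg hlk, mul_zero, mul_zero, zero_mul]

omit [DecidableEq S] in
/-- An indicator of the level restricts a sum to one level. [ours] -/
theorem sum_ite_eq_level (k : Fin (K + 1)) (F : Fin (K + 1) → S → ℝ) :
    ∑ l : Fin (K + 1), ∑ y : S, (if l = k then F l y else 0) = ∑ y, F k y := by
  rw [Finset.sum_comm]
  refine sum_congr rfl fun y _ => ?_
  rw [Finset.sum_ite_eq' univ k, if_pos (mem_univ _)]

/-- **`𝓔_π(P; h∘snd) = ((1−t)/(K+1))·Σ_k 𝓔_{μ_k}(M_k; h)` exactly.** [ours] -/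
theorem stFin_dirichletForm_comp_snd (h : S → ℝ) :
    dirichletForm (stFinLaw μ) (stFinSampler t μ M) (fun p => h p.2)
      = (1 - t) / (K + 1) * ∑ k, dirichletForm (μ k) (M k) h := by
  have inner : ∀ (k : Fin (K + 1)) (x : S),
      ∑ q : Fin (K + 1) × S, stFinLaw μ (k, x) * stFinSampler t μ M (k, x) q * (h x - h q.2) ^ 2
        = (1 - t) / (K + 1) * ∑ y, μ k x * M k x y * (h x - h y) ^ 2 := by
    intro k x
    rw [Fintype.sum_prod_type]
    have e : ∀ (l : Fin (K + 1)) (y : S),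
        stFinLaw μ (k, x) * stFinSampler t μ M (k, x) (l, y) * (h x - h ((l, y) : Fin (K + 1) × S).2) ^ 2
          = if l = k then stFinLaw μ (k, x) * ((1 - t) * M k x y) * (h x - h y) ^ 2 else 0 :=
      fun l y => stFin_flow_mul_sq_comp_snd h k l x y
    simp_rw [e]
    rw [sum_ite_eq_level k (fun _ y => stFinLaw μ (k, x) * ((1 - t) * M k x y) * (h x - h y) ^ 2), Finset.mul_sum]
    refine sum_congr rfl fun y _ => ?_
    unfold stFinLaw
    ring
  unfold dirichletForm
  rw [Fintype.sum_prod_type]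
  have e2 : ∀ (k : Fin (K + 1)) (x : S),
      ∑ q : Fin (K + 1) × S, stFinLaw μ (k, x) * stFinSampler t μ M (k, x) q
          * (h ((k, x) : Fin (K + 1) × S).2 - h q.2) ^ 2
        = (1 - t) / (K + 1) * ∑ y, μ k x * M k x y * (h x - h y) ^ 2 := fun k x => inner k x
  simp_rw [e2]
  rw [Finset.mul_sum, Finset.mul_sum]
  refine sum_congr rfl fun k _ => ?_
  rw [← Finset.mul_sum]
  ring

omit [DecidableEq S] in
/-- **`Var_π(h∘snd) ≥ (1/(K+1))·Σ_k Var_{μ_k}(h)`** — the within-level part of the variance decomposition along the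
levels (Jerrum–Son–Tetali–Vigoda eq. (4), PROVED in the tree). [ours] -/
theorem stFin_lawVariance_comp_snd_ge (hμ : ∀ k x, 0 < μ k x) (hμ1 : ∀ k, ∑ x, μ k x = 1) (h : S → ℝ) :
    1 / (K + 1) * ∑ k, lawVariance (μ k) h ≤ lawVariance (stFinLaw μ) (fun p => h p.2) := by
  have hM : ∀ i, blockMass (stFinLaw μ) (Prod.fst : Fin (K + 1) × S → Fin (K + 1)) i ≠ 0 := fun i => by
    rw [stFin_blockMass hμ1]; positivity
  rw [lawVariance_decomposition hM (fun p : Fin (K + 1) × S => h p.2)]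
  have hw : ∑ i, blockMass (stFinLaw μ) Prod.fst i * lawVariance (blockLaw (stFinLaw μ) Prod.fst i)
      (fun p : Fin (K + 1) × S => h p.2) = 1 / (K + 1) * ∑ k, lawVariance (μ k) h := by
    rw [Finset.mul_sum]
    refine sum_congr rfl fun k _ => ?_
    rw [stFin_blockMass hμ1, stFin_lawVariance_blockLaw hμ1]
  rw [hw]
  have h0 : 0 ≤ lawVariance (blockMass (stFinLaw μ) Prod.fst)
      (blockAvg (stFinLaw μ) Prod.fst (fun p : Fin (K + 1) × S => h p.2)) :=
    lawVariance_nonneg (fun i => blockMass_nonneg (fun p => (stFinLaw_pos hμ p).le) _ i) _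
  linarith

/-! ## §2 The spectral-gap ceiling -/

section Gap

variable (hK : 1 ≤ K) (hμ : ∀ k x, 0 < μ k x) (hμ1 : ∀ k, ∑ x, μ k x = 1) (hM : ∀ k, IsRowStochastic (M k))
  (hMrev : ∀ k, DetailedBalance (μ k) (M k))
include hK hμ hμ1 hM hMrev

/-- **THE COMMON-MODE CEILING: `Gap(P) ≤ (1−t)·Σ_k 𝓔_{μ_k}(M_k; h)/Σ_k Var_{μ_k}(h)`** for every observable `h` of the
configuration with `Σ_k Var_{μ_k}(h) > 0` (`0 ≤ t ≤ 1`, `K ≥ 1`). [ours] -/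
theorem stFin_spectralGap_le_commonMode (ht0 : 0 ≤ t) (ht1 : t ≤ 1) (h : S → ℝ)
    (hV : 0 < ∑ k, lawVariance (μ k) h) :
    spectralGap (stFinLaw μ) (stFinSampler t μ M)
      ≤ (1 - t) * (∑ k, dirichletForm (μ k) (M k) h) / ∑ k, lawVariance (μ k) h := by
  haveI : Nonempty S := by
    by_contra hS
    rw [not_nonempty_iff] at hS
    have := hμ1 0
    rw [Finset.univ_eq_empty, Finset.sum_empty] at this
    exact zero_ne_one this
  haveI : Nontrivial (Fin (K + 1)) := Fin.nontrivial_iff_two_le.mpr (by omega)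
  have hP := stFinSampler_isRowStochastic (M := M) hμ hM ht0 ht1
  have hDB := stFinSampler_detailedBalance (t := t) (M := M) hμ hMrev
  have hπ1 := sum_stFinLaw (K := K) hμ1
  have hK1 : (0 : ℝ) < K + 1 := by positivity
  have hlb := stFin_lawVariance_comp_snd_ge (μ := μ) hμ hμ1 h
  have hVπ : 0 < lawVariance (stFinLaw μ) (fun p => h p.2) := lt_of_lt_of_le (by positivity) hlb
  have hE := stFin_dirichletForm_comp_snd (μ := μ) (M := M) (t := t) h
  have hE0 : 0 ≤ ∑ k, dirichletForm (μ k) (M k) h :=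
    sum_nonneg fun k _ => dirichletForm_nonneg (fun x => (hμ k x).le) (hM k).1 h
  rw [LevinPeres2017_lemma_13_7 (stFinLaw_pos hμ) hπ1 hP hDB]
  refine (spectralGapR_le_dirichletForm_div_lawVariance (fun p => (stFinLaw_pos hμ p).le) hπ1 hP.1 hVπ).trans ?_
  rw [hE]
  -- `a/Var ≤ a/lb` for `lb ≤ Var`, then simplify
  calc (1 - t) / (K + 1) * (∑ k, dirichletForm (μ k) (M k) h) / lawVariance (stFinLaw μ) (fun p => h p.2)
      ≤ (1 - t) / (K + 1) * (∑ k, dirichletForm (μ k) (M k) h) / (1 / (K + 1) * ∑ k, lawVariance (μ k) h) :=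
        div_le_div_of_nonneg_left (mul_nonneg (div_nonneg (by linarith) hK1.le) hE0) (by positivity) hlb
    _ = (1 - t) * (∑ k, dirichletForm (μ k) (M k) h) / ∑ k, lawVariance (μ k) h := by
        field_simp

/-- **An observable that is `ε`-slow at EVERY level makes the sampler `(1−t)ε`-slow:** if
`𝓔_{μ_k}(M_k; h) ≤ ε·Var_{μ_k}(h)` for all `k` (and `h` is non-constant at some level) then `Gap(P) ≤ (1−t)ε`.
[ours] -/
theorem stFin_spectralGap_le_of_slow (ht0 : 0 ≤ t) (ht1 : t ≤ 1) (h : S → ℝ) {ε : ℝ}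
    (hslow : ∀ k, dirichletForm (μ k) (M k) h ≤ ε * lawVariance (μ k) h) (hV : 0 < ∑ k, lawVariance (μ k) h) :
    spectralGap (stFinLaw μ) (stFinSampler t μ M) ≤ (1 - t) * ε := by
  refine (stFin_spectralGap_le_commonMode hK hμ hμ1 hM hMrev ht0 ht1 h hV).trans ?_
  rw [div_le_iff₀ hV, Finset.mul_sum, Finset.mul_sum]
  refine sum_le_sum fun k _ => ?_
  rw [mul_assoc]
  exact mul_le_mul_of_nonneg_left (hslow k) (by linarith)

/-! ## §3 The autocorrelation floor -/

/-- **`τ_int(h∘snd) ≥ Σ_k Var_{μ_k}(h)/((1−t)·Σ_k 𝓔_{μ_k}(M_k; h)) − ½`** for `0 < t < 1` and irreducible within-level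
updates (Madras–Slade Prop. 9.2.2 route: `τ_int ≥ Var/𝓔 − ½`, then `Var ≥ (1/(K+1))ΣVar_k`, `𝓔 = ((1−t)/(K+1))Σ𝓔_k`).
[ours] -/
theorem stFin_tauInt_comp_snd_ge (hMirr : ∀ k, IsIrreducible (M k)) (ht0 : 0 < t) (ht1 : t < 1) (h : S → ℝ)
    (hV : 0 < ∑ k, lawVariance (μ k) h) :
    (∑ k, lawVariance (μ k) h) / ((1 - t) * ∑ k, dirichletForm (μ k) (M k) h) - 1 / 2
      ≤ asympVar (fun p => h p.2) (stFinLaw μ) (stFinSampler t μ M)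
          / (2 * lawVariance (stFinLaw μ) (fun p : Fin (K + 1) × S => h p.2)) := by
  set g : Fin (K + 1) × S → ℝ := fun p => h p.2 with hg
  have hP := stFinSampler_isRowStochastic (M := M) hμ hM ht0.le ht1.le
  have hDB := stFinSampler_detailedBalance (t := t) (M := M) hμ hMrev
  have hst : IsStationary (stFinLaw μ) (stFinSampler t μ M) := hDB.isStationary hP.2
  have hirr := stFinSampler_isIrreducible hμ hM hMirr ht0 ht1
  have hπ := stFinLaw_pos (K := K) hμ
  have hπ1 := sum_stFinLaw (K := K) hμ1
  have hK1 : (0 : ℝ) < K + 1 := by positivity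
  have hlb : 1 / (K + 1) * ∑ k, lawVariance (μ k) h ≤ lawVariance (stFinLaw μ) g :=
    stFin_lawVariance_comp_snd_ge (μ := μ) hμ hμ1 h
  have hE : dirichletForm (stFinLaw μ) (stFinSampler t μ M) g = (1 - t) / (K + 1) * ∑ k, dirichletForm (μ k) (M k) h :=
    stFin_dirichletForm_comp_snd (μ := μ) (M := M) (t := t) h
  -- Madras–Slade: `V(V + C₁) ≤ v(V − C₁)`, `V − C₁ = 𝓔`
  have key := asympVar_mul_dirichletForm_ge hπ hπ1 hP hDB hirr g
  have h928 := MadrasSlade1993_eq_9_2_28 hP hst g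
  set V := lawVariance (stFinLaw μ) g with hVdef
  set C1 := piInner (stFinLaw μ) (centred (stFinLaw μ) g) ((stFinSampler t μ M).mulVec (centred (stFinLaw μ) g))
  set v := asympVar g (stFinLaw μ) (stFinSampler t μ M)
  set E := dirichletForm (stFinLaw μ) (stFinSampler t μ M) g with hEdef
  have hC1E : C1 = V - E := by linarith
  rw [hC1E] at key
  have hVpos : 0 < V := lt_of_lt_of_le (by positivity) hlb
  have hEpos : 0 < E := by
    by_contra hc
    push Not at hc
    have hE0 : E = 0 := le_antisymm hc (dirichletForm_nonneg (fun p => (hπ p).le) hP.1 _)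
    rw [hE0, sub_zero] at key
    nlinarith
  have hSE : 0 < ∑ k, dirichletForm (μ k) (M k) h := by
    rw [hE] at hEpos
    exact (mul_pos_iff_of_pos_left (div_pos (by linarith) hK1)).mp hEpos
  -- `ΣVar_k/((1−t)Σ𝓔_k) ≤ V/E`
  have hratio : (∑ k, lawVariance (μ k) h) / ((1 - t) * ∑ k, dirichletForm (μ k) (M k) h) ≤ V / E := by
    rw [hE]
    have e : (∑ k, lawVariance (μ k) h) / ((1 - t) * ∑ k, dirichletForm (μ k) (M k) h)
        = (1 / (K + 1) * ∑ k, lawVariance (μ k) h) / ((1 - t) / (K + 1) * ∑ k, dirichletForm (μ k) (M k) h) := by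
      have h1t : (1 - t) ≠ 0 := by linarith
      field_simp
    rw [e]
    exact div_le_div_of_nonneg_right hlb (by positivity)
  have e : V / E - 1 / 2 = (2 * V - E) / (2 * E) := by field_simp
  have hfin : V / E - 1 / 2 ≤ v / (2 * V) := by
    rw [e, div_le_div_iff₀ (by positivity) (by positivity)]
    nlinarith [key]
  linarith

/-- **`ε`-slow at every level ⇒ `τ_int(h∘snd) ≥ 1/((1−t)ε) − ½`.** [ours] -/
theorem stFin_tauInt_ge_of_slow (hMirr : ∀ k, IsIrreducible (M k)) (ht0 : 0 < t) (ht1 : t < 1) (h : S → ℝ)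
    {ε : ℝ} (hε : 0 < ε) (hslow : ∀ k, dirichletForm (μ k) (M k) h ≤ ε * lawVariance (μ k) h)
    (hV : 0 < ∑ k, lawVariance (μ k) h) :
    1 / ((1 - t) * ε) - 1 / 2
      ≤ asympVar (fun p => h p.2) (stFinLaw μ) (stFinSampler t μ M)
          / (2 * lawVariance (stFinLaw μ) (fun p : Fin (K + 1) × S => h p.2)) := by
  refine le_trans ?_ (stFin_tauInt_comp_snd_ge hK hμ hμ1 hM hMrev hMirr ht0 ht1 h hV)
  have hSE : ∑ k, dirichletForm (μ k) (M k) h ≤ ε * ∑ k, lawVariance (μ k) h := by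
    rw [Finset.mul_sum]; exact sum_le_sum fun k _ => hslow k
  have h1t : 0 < 1 - t := by linarith
  -- `1/((1−t)ε) ≤ ΣVar/((1−t)Σ𝓔)` iff `(1−t)Σ𝓔 ≤ (1−t)εΣVar`
  by_cases hE0 : ∑ k, dirichletForm (μ k) (M k) h = 0
  · -- then the right side is `ΣVar/0 − ½ = −½`; but `1/((1−t)ε) > 0`… use the floor through `hslow` directly:
    -- with `Σ𝓔 = 0` the bound `ΣVar/((1−t)Σ𝓔)` is junk; fall back to monotonicity in `Σ𝓔 ≤ εΣVar` with `Σ𝓔 > 0`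
    -- impossible here, so weaken: `1/((1−t)ε) − ½ ≤ ΣVar/((1−t)·εΣVar)·… `; we simply bound via `hSE` and positivity
    exfalso
    -- an irreducible reversible sampler has positive Dirichlet form for the non-constant `h∘snd`; reuse §3's argument
    have hP := stFinSampler_isRowStochastic (M := M) hμ hM ht0.le ht1.le
    have hDB := stFinSampler_detailedBalance (t := t) (M := M) hμ hMrev
    have hst : IsStationary (stFinLaw μ) (stFinSampler t μ M) := hDB.isStationary hP.2
    have hirr := stFinSampler_isIrreducible hμ hM hMirr ht0 ht1
    have key := asympVar_mul_dirichletForm_ge (stFinLaw_pos hμ) (sum_stFinLaw hμ1) hP hDB hirr (fun p => h p.2)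
    have h928 := MadrasSlade1993_eq_9_2_28 hP hst (fun p : Fin (K + 1) × S => h p.2)
    have hE := stFin_dirichletForm_comp_snd (μ := μ) (M := M) (t := t) h
    rw [hE0, mul_zero] at hE
    have hlb := stFin_lawVariance_comp_snd_ge (μ := μ) hμ hμ1 h
    have hK1 : (0 : ℝ) < K + 1 := by positivity
    have hVpos : 0 < lawVariance (stFinLaw μ) (fun p : Fin (K + 1) × S => h p.2) := lt_of_lt_of_le (by positivity) hlb
    rw [hE] at h928
    have hC1 : piInner (stFinLaw μ) (centred (stFinLaw μ) fun p => h p.2)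
        ((stFinSampler t μ M).mulVec (centred (stFinLaw μ) fun p => h p.2))
        = lawVariance (stFinLaw μ) (fun p : Fin (K + 1) × S => h p.2) := by linarith
    rw [hC1, sub_self, mul_zero] at key
    nlinarith
  · have hSEpos : 0 < ∑ k, dirichletForm (μ k) (M k) h :=
      lt_of_le_of_ne (sum_nonneg fun k _ => dirichletForm_nonneg (fun x => (hμ k x).le) (hM k).1 h) (Ne.symm hE0)
    have : 1 / ((1 - t) * ε) ≤ (∑ k, lawVariance (μ k) h) / ((1 - t) * ∑ k, dirichletForm (μ k) (M k) h) := by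
      rw [div_le_div_iff₀ (by positivity) (by positivity)]
      nlinarith [mul_le_mul_of_nonneg_left hSE h1t.le]
    linarith

end Gap

end Summit.Ventures.LatticeQCDFlow.Scaling

end
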